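import Summits.ResolutionOfSingularities.ResolutionOfSingularities.Theorems.FrobeniusLadderFRationalResolutionGaloisResidueGalois
import HarnessLib

/-!
# Crux `FrobeniusLadder.FRationalResolution` (stmt-ResolutionOfSingularities-15317), line `redirect`,
# stub `stub_diagonalizableQuotientResolution` — THE FIXED-POINT CRITERION: `hfix` ⟺ the residue embedding lands in `κ(𝔭)`

One quotable statement assembling ✓ `…GaloisTwistedPointObstruction` and ✓ `…GaloisResidueGalois`: for `K'/K` finite Galois,
`𝔭 ⊆ B` maximal, `𝔔' ⊆ B' = B ⊗_K K'` maximal over `𝔭`, and a point `𝔚` of the chart `B' ⊗_B C` over `𝔔'` belonging to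
`ι : C/𝔔 → B'/𝔔'`, the hypothesis `hfix` of ✓ `…GaloisFixedPointPiece` («every chart twist of the decomposition group fixes `𝔚`») holds
IF AND ONLY IF every value `ι(c̄)` is the class of some `b ⊗ 1`, i.e. `ι(κ(𝔔)) ⊆ κ(𝔭)`: the residue-trivial case. So the fixed-point
shortcut of the Galois route closes exactly the residue-trivial points and nothing else (memo MEMO-15317-leafhand2-g15 §2(a)).

* **`forall_map_chartTwist_eq_iff`** — the criterion.

Honest label: plumbing/structure toward ONE leaf stub (no stub, crux or summit closed). No definitions, no named facts, no sorry.
[cite: StacksProject, Tag 0BRI; Tag 09EB; Tag 00UW]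
-/

noncomputable section

-- single-problem summit: the doubled namespace component is forced
set_option linter.dupNamespace false

open scoped TensorProduct

namespace Summit.ResolutionOfSingularities.ResolutionOfSingularities.Theorems.FRationalResolution.GaloisFixedPointCriterion

variable {K B K' C : Type} [Field K] [CommRing B] [Algebra K B] [Field K'] [Algebra K K'] [CommRing C] [Algebra B C]

/-- **The fixed-point criterion.** `K'/K` finite Galois, `𝔭 ⊆ B` maximal, `𝔔' ⊆ B ⊗_K K'` maximal over `𝔭`, `𝔚` a point of the
chart over `𝔔'` belonging to `ι : C/𝔔 → B'/𝔔'`. Then every chart twist `σ''` with `(1 ⊗ σ) 𝔔' = 𝔔'` fixes `𝔚` iff every `ι(c̄)` is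
the class of some `b ⊗ 1`. [cite: StacksProject, Tag 0BRI; Tag 09EB; Tag 00UW] -/
theorem forall_map_chartTwist_eq_iff [FiniteDimensional K K'] [IsGalois K K'] (𝔭 : Ideal B) [𝔭.IsMaximal]
    (𝔔 : Ideal C) (𝔔' : Ideal (B ⊗[K] K')) [𝔔'.IsMaximal]
    (h𝔔'𝔭 : 𝔔'.comap (algebraMap B (B ⊗[K] K')) = 𝔭)
    (ι : C ⧸ 𝔔 →+* (B ⊗[K] K') ⧸ 𝔔') (𝔚 : Ideal ((B ⊗[K] K') ⊗[B] C))
    (h𝔚B : 𝔚.comap (algebraMap (B ⊗[K] K') ((B ⊗[K] K') ⊗[B] C)) = 𝔔')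
    (hι : ∀ (c : C) (b' : B ⊗[K] K'), Ideal.Quotient.mk 𝔔' b' = ι (Ideal.Quotient.mk 𝔔 c) →
      (Algebra.TensorProduct.includeRight : C →ₐ[B] (B ⊗[K] K') ⊗[B] C) c -
        algebraMap (B ⊗[K] K') ((B ⊗[K] K') ⊗[B] C) b' ∈ 𝔚) :
    (∀ σ : K' ≃ₐ[K] K',
        𝔔'.map (Algebra.TensorProduct.map (AlgHom.id B B) (σ : K' →ₐ[K] K')) = 𝔔' →
        𝔚.map (Algebra.TensorProduct.map (Algebra.TensorProduct.map (AlgHom.id B B) (σ : K' →ₐ[K] K'))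
          (AlgHom.id B C)) = 𝔚) ↔
      ∀ c : C, ∃ b : B, Ideal.Quotient.mk 𝔔' (algebraMap B (B ⊗[K] K') b) = ι (Ideal.Quotient.mk 𝔔 c) := by
  constructor
  · intro hfix c
    by_contra hc
    simp only [not_exists] at hc
    obtain ⟨σ, hσ, hne⟩ :=
      GaloisResidueGalois.exists_decomposition_chartTwist_ne_of_not_mem_range 𝔭 𝔔 𝔔' h𝔔'𝔭 ι 𝔚 h𝔚B hι c hc
    exact hne (hfix σ hσ)
  · intro hrange σ hσ
    refine GaloisTwistedPointObstruction.map_chartTwist_eq_of_forall_ringHom 𝔔 𝔔' ι 𝔚 h𝔚B hι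
      (fun f hf => RingHom.ext fun y => ?_) σ hσ
    obtain ⟨c, rfl⟩ := Ideal.Quotient.mk_surjective y
    obtain ⟨b, hb⟩ := hrange c
    rw [RingHom.comp_apply, ← hb, hf b]

end Summit.ResolutionOfSingularities.ResolutionOfSingularities.Theorems.FRationalResolution.GaloisFixedPointCriterion

end
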